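import Literature.NumberTheory.Sieve.MoebiusWalshCircuits
import Literature.NumberTheory.LFunctions.MoebiusWalshCircuits
import HarnessLib

/-!
# Green 2012, Theorem 1: the `Sieve` fact `green_moebius_AC0` versus the `LFunctions` fact
# `green_moebius_ACd` (proved bridge)

Topic `Literature/NumberTheory/Sieve`; a proofs companion of `MoebiusWalshCircuits.lean` for its
named fact `Literature.NumberTheory.Sieve.green_moebius_AC0` = B. Green, *On (not) computing the
Möbius function using bounded depth circuits*, Combin. Probab. Comput. 21 (2012) 942–951
(arXiv:1103.4991), **Theorem 1**, as printed. Everything here is PROVED (theorems only, no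
definition, no named fact).

The same printed theorem is vendored twice in the tree, with the same hypotheses (`d ≥ 1`,
`n ≥ 1`, circuits over `acBasis` with `Circuit.depth ≤ d`, `Circuit.size ≤ n ^ d`, absolute
constants `c > 0`, `K`) and the same bound `K · exp (d log n − c n^{1/(6d)})`, in two vocabularies:

* here (`Literature.NumberTheory.Sieve.green_moebius_AC0`): the average is
  `|∑_{x ∈ range (2^n)} μ(x) · sgn (C.eval (i ↦ x.testBit i))| / 2^n` (digits read by
  `Nat.testBit`, sign `sgn true = −1`);
* in `Literature/NumberTheory/LFunctions/MoebiusWalshCircuits.lean`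
  (`Literature.NumberTheory.LFunctions.green_moebius_ACd`): the average is
  `|circuitCorrelation μ C| / 2^n`, a sum over the cube `x : Fin n → Bool` of
  `μ (bitsToNat (List.ofFn x)) · (if C.eval x then 1 else −1)`.

We prove `green_moebius_AC0_iff_ACd : green_moebius_AC0 ↔ LFunctions.green_moebius_ACd`:
binary expansion `x ↦ ∑ᵢ xᵢ 2ⁱ = bitsToNat (List.ofFn x)` is a bijection
`{0,1}ⁿ ≃ {0, …, 2ⁿ − 1}` whose inverse reads the digits by `Nat.testBit`
(`sum_cube_eq_sum_range_testBit`), and the two sign conventions differ by a global sign, which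
`|·|` ignores (`circuitCorrelation_eq_neg_sum_range`). Hence this topic's fact is discharged the
moment its `LFunctions` twin is — and that twin is Green's §2 deduction (Linial–Mansour–Nisan /
Tal, Parseval, Cauchy–Schwarz, the prime number theorem at the empty level) applied to Green's
Proposition 1 (`Literature.NumberTheory.LFunctions.green_moebius_fourierWalsh`, the deep part of
the paper: Kátai's argument, the zero-free region for characters of `2`-power conductor, minor
arcs), both of which are being proved elsewhere in the tree; nothing of that is redone here.

## References

* B. Green, *On (not) computing the Möbius function using bounded depth circuits*, Combin.
  Probab. Comput. 21 (2012) 942–951, Theorem 1, §1 (conventions: `μ(0) = 0`,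
  `x = x₁ + 2x₂ + ⋯ + 2^{n−1}xₙ`) [Green2012].
-/

open Finset
open Literature.Computability.Complexity
open Literature.Probability.RandomGraphs.LowDegree (sgn)

namespace Literature.NumberTheory.Sieve

/-! ### Binary digits: `bitsToNat ∘ List.ofFn` versus `Nat.testBit` -/

/-- The bits of `bitsToNat l` are the entries of `l`: `(∑ᵢ lᵢ 2ⁱ).testBit t = l[t]` (digit `t` =
coefficient of `2ᵗ`; several twins of this statement live in `Literature/Computability`, none in a
module this topic should import). [folklore] -/
private theorem testBit_bitsToNat (l : List Bool) (t : ℕ) :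
    (bitsToNat l).testBit t = l.getD t false := by
  induction l generalizing t with
  | nil => simp
  | cons b l ih =>
    rw [bitsToNat_cons]
    cases t with
    | zero =>
      rw [Nat.testBit_zero]
      cases b <;> simp [Nat.add_mod]
    | succ t =>
      rw [Nat.testBit_add_one, List.getD_cons_succ, ← ih]
      congr 1
      have hb : b.toNat ≤ 1 := Bool.toNat_le b
      omega

/-- The digits of the number with digit vector `x : Fin n → Bool` are `x`. [folklore] -/
private theorem testBit_bitsToNat_ofFn {n : ℕ} (x : Fin n → Bool) (i : Fin n) :
    (bitsToNat (List.ofFn x)).testBit i = x i := by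
  rw [testBit_bitsToNat, List.getD_eq_getElem?_getD, List.getElem?_ofFn]
  simp [i.isLt]

/-- Reading off the `n` low digits of `m < 2ⁿ` and reassembling gives back `m`. [folklore] -/
private theorem bitsToNat_ofFn_testBit {n m : ℕ} (hm : m < 2 ^ n) :
    bitsToNat (List.ofFn fun i : Fin n => m.testBit i) = m := by
  refine Nat.eq_of_testBit_eq fun t => ?_
  rw [testBit_bitsToNat, List.getD_eq_getElem?_getD, List.getElem?_ofFn]
  by_cases ht : t < n
  · simp [ht]
  · simp only [ht, ↓reduceDIte, Option.getD_none]
    exact (Nat.testBit_eq_false_of_lt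
      (hm.trans_le (Nat.pow_le_pow_right Nat.two_pos (Nat.not_lt.mp ht)))).symm

/-- **Summing over the cube is summing over `0 ≤ m < 2ⁿ`** with the digits read by `Nat.testBit`:
`∑_{x ∈ {0,1}ⁿ} F(x) = ∑_{m < 2ⁿ} F(i ↦ m.testBit i)` (binary expansion
`x ↦ bitsToNat (List.ofFn x) = ∑ᵢ xᵢ 2ⁱ` is a bijection `{0,1}ⁿ ≃ {0, …, 2ⁿ − 1}`). [folklore] -/
theorem sum_cube_eq_sum_range_testBit {M : Type*} [AddCommMonoid M] (n : ℕ)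
    (F : (Fin n → Bool) → M) :
    ∑ x : Fin n → Bool, F x = ∑ m ∈ range (2 ^ n), F (fun i : Fin n => m.testBit i) := by
  refine Finset.sum_nbij' (fun x : Fin n → Bool => bitsToNat (List.ofFn x))
    (fun m : ℕ => fun i : Fin n => m.testBit i) ?_ ?_ ?_ ?_ ?_
  · intro x _
    exact mem_range.2 (by simpa using bitsToNat_lt (List.ofFn x))
  · intro m _
    exact mem_univ _
  · intro x _
    funext i
    exact testBit_bitsToNat_ofFn x i
  · intro m hm
    exact bitsToNat_ofFn_testBit (mem_range.1 hm)
  · intro x _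
    congr 1
    funext i
    exact (testBit_bitsToNat_ofFn x i).symm

/-- The `LFunctions` circuit correlation (cube sum, value `bitsToNat (List.ofFn x)`, sign
`C(x) = true ↦ +1`) is minus this topic's sum over `range (2^n)` with digits `Nat.testBit` and
sign `sgn` (`sgn true = −1`):
`circuitCorrelation g C = −∑_{m < 2ⁿ} g(m) · sgn (C.eval (i ↦ m.testBit i))`. [folklore] -/
theorem circuitCorrelation_eq_neg_sum_range {n : ℕ} (g : ℕ → ℤ) (C : Circuit (Fin n)) :
    LFunctions.circuitCorrelation g C =
      -∑ m ∈ range (2 ^ n), (g m : ℝ) * sgn (C.eval fun i : Fin n => m.testBit i) := by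
  unfold LFunctions.circuitCorrelation
  rw [sum_cube_eq_sum_range_testBit, ← sum_neg_distrib]
  refine sum_congr rfl fun m hm => ?_
  rw [bitsToNat_ofFn_testBit (mem_range.1 hm)]
  rcases Bool.eq_false_or_eq_true (C.eval fun i : Fin n => m.testBit i) with h | h <;>
    simp [h, sgn]

/-- **Dedup bridge for Green 2012, Theorem 1 (Möbius).** The two vendored forms of the printed
theorem are equivalent: `green_moebius_AC0` (this topic: `range (2^n)`, `Nat.testBit`, sign `sgn`)
`↔` `Literature.NumberTheory.LFunctions.green_moebius_ACd` (cube sum `circuitCorrelation`, sign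
`true ↦ +1`), with the SAME absolute constants `c > 0`, `K` — the two averages have the same
absolute value (`circuitCorrelation_eq_neg_sum_range`). Consequently
`green_moebius_AC0_holds := green_moebius_AC0_iff_ACd.2 ‹green_moebius_ACd›` as soon as the
`LFunctions` twin is discharged (Green's §2 deduction from his Proposition 1,
`Literature.NumberTheory.LFunctions.green_moebius_fourierWalsh`). [cite: Green2012, Theorem 1] -/
theorem green_moebius_AC0_iff_ACd : green_moebius_AC0 ↔ LFunctions.green_moebius_ACd := by
  unfold green_moebius_AC0 LFunctions.green_moebius_ACd
  refine exists_congr fun c => and_congr_right fun _ => exists_congr fun K => ?_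
  constructor
  · intro h d n hd hn C hC hdepth hsize
    rw [circuitCorrelation_eq_neg_sum_range, abs_neg]
    exact h d hd n hn C hC hdepth hsize
  · intro h d hd n hn C hC hdepth hsize
    have key := h d n hd hn C hC hdepth hsize
    rwa [circuitCorrelation_eq_neg_sum_range, abs_neg] at key

/-- `green_moebius_AC0` from its `LFunctions` twin (one direction of `green_moebius_AC0_iff_ACd`,
named for the discharge `green_moebius_AC0_holds := green_moebius_AC0_of_ACd ‹_›`).
[cite: Green2012, Theorem 1] -/
theorem green_moebius_AC0_of_ACd (h : LFunctions.green_moebius_ACd) : green_moebius_AC0 :=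
  green_moebius_AC0_iff_ACd.2 h

end Literature.NumberTheory.Sieve
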